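import Literature.Geometry.Lorentzian.VolumeChartIntegral
import Mathlib.Geometry.Manifold.IsManifold.InteriorBoundary
import Mathlib.Analysis.Calculus.InverseFunctionTheorem.FDeriv
import Mathlib.MeasureTheory.Function.Jacobian
import HarnessLib

/-!
# Budget transfer, seam part: the image of the interior is open, the image of the boundary is null

Support file (everything proved; no definitions, no named facts) for the support item
`BudgetTransfer` of route WeylBudget (item stmt-SmoothPoincare4-3208). For a piece `C` — a manifold
with boundary or corners — mapped into a boundaryless manifold `P` of the same dimension by a smooth
map `j` with injective differential:

* `map_nhds_eq_of_isInteriorPoint`, `isOpen_image_interior` — **at interior points `j` is open**: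
  `j` maps neighbourhoods of an interior point `c` onto neighbourhoods of `j c` (inverse function
  theorem in charts, `HasStrictFDerivAt.map_nhds_eq_of_equiv`), so `j(Int C)` is open
  (Lee 2013, Thm. 4.5 and Prop. 4.8);
* `riemannianMeasure_source_inter_preimage_eq_zero` — Lebesgue-null sets in a chart are null for the
  Riemannian measure (`map_extChartAt_restrict_riemannianMeasure`: `φ_* dV|_{φ.source}` has a density
  with respect to Lebesgue measure; Federer 1969, §3.2.46);
* `riemannianMeasure_image_boundary_eq_zero` — **the seam is a null set**: for `C` modelled on the
  half-space `ℝⁿ_{x₀ ≥ 0}`, `dV_h(j(∂C)) = 0` for every Riemannian metric `h` on `P` — read in charts,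
  `j(∂C)` is locally the `C¹` image of a piece of the hyperplane `{x₀ = 0}`, which is Lebesgue-null,
  and `C¹` maps preserve Lebesgue-null sets (Federer 1969, §2.10.11 / §3.2.3; Mathlib's
  `addHaar_image_eq_zero_of_differentiableOn_of_addHaar_eq_zero`).

## References

* J. M. Lee, *Introduction to Smooth Manifolds*, 2nd ed. (2013), Thm. 4.5, Prop. 4.8.
  [LeeSmoothManifolds2013]
* H. Federer, *Geometric Measure Theory* (1969), §2.10.11, §3.2.3, §3.2.46. [Federer1969]
-/

noncomputable section

-- the registered namespace `Summit.SmoothPoincare4.SmoothPoincare4.Theorems` repeats a component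
set_option linter.dupNamespace false

open Bundle Set Function Filter MeasureTheory Measure Manifold Module Topology
open scoped Manifold ContDiff Topology

namespace Summit.SmoothPoincare4.SmoothPoincare4.Theorems

namespace BudgetTransfer

open Literature.Geometry.Lorentzian

/-! ### Interior points: `j` is open there -/

section Interior

variable {E : Type*} [NormedAddCommGroup E] [NormedSpace ℝ E] [FiniteDimensional ℝ E]
  [CompleteSpace E]
  {HC : Type*} [TopologicalSpace HC] {IC : ModelWithCorners ℝ E HC}
  {C : Type*} [TopologicalSpace C] [ChartedSpace HC C] [IsManifold IC ∞ C]
  {HP : Type*} [TopologicalSpace HP] {IP : ModelWithCorners ℝ E HP} [IP.Boundaryless]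
  {P : Type*} [TopologicalSpace P] [ChartedSpace HP P] [IsManifold IP ∞ P]
  {j : C → P}

omit [IsManifold IC ∞ C] [IsManifold IP ∞ P] in
/-- **At an interior point, a smooth equidimensional map with injective differential is open**:
`j` maps the neighbourhood filter of `c` onto that of `j c`. In the charts `φ` at `c` and `ψ` at
`j c`, `j = ψ⁻¹ ∘ G ∘ φ` near `c` with `G = ψ ∘ j ∘ φ⁻¹` of class `C^∞` at `φ c` (an honest
neighbourhood, `c` being interior) and `DG(φ c) ≅ dj_c` a linear isomorphism, so `G` is open at
`φ c` (inverse function theorem, `HasStrictFDerivAt.map_nhds_eq_of_equiv`); `φ` and `ψ⁻¹` are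
open at `c`, `ψ (j c)`. [cite: LeeSmoothManifolds2013, Thm. 4.5] -/
theorem map_nhds_eq_of_isInteriorPoint (hj : ContMDiff IC IP ∞ j)
    (hj' : ∀ c, Injective (mfderiv IC IP j c)) {c : C} (hc : IC.IsInteriorPoint c) :
    map j (𝓝 c) = 𝓝 (j c) := by
  set φ := extChartAt IC c with hφ
  set ψ := extChartAt IP (j c) with hψ
  set G : E → E := ψ ∘ j ∘ φ.symm with hG
  -- `range IC` is a neighbourhood of `φ c`
  have hrange : range IC ∈ 𝓝 (φ c) := mem_interior_iff_mem_nhds.1 hc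
  -- `G` is `C^∞` at `φ c` with derivative `dj_c`, an isomorphism
  have hjc : ContMDiffAt IC IP ∞ j c := hj c
  have hGs : ContDiffAt ℝ ∞ G (φ c) := (contMDiffAt_iff.1 hjc).2.contDiffAt hrange
  have hmd : MDifferentiableAt IC IP j c := hjc.mdifferentiableAt (by simp)
  have hder : mfderiv IC IP j c = fderiv ℝ G (φ c) := by
    rw [hmd.mfderiv, fderivWithin_of_mem_nhds hrange]
    rfl
  have hinj : Injective (fderiv ℝ G (φ c)) := by
    have h := hj' c
    rwa [hder] at h
  have hbij : Bijective (fderiv ℝ G (φ c)) :=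
    ⟨hinj, (LinearMap.injective_iff_surjective (f := (fderiv ℝ G (φ c) : E →ₗ[ℝ] E))).1 hinj⟩
  set L : E ≃L[ℝ] E :=
    (LinearEquiv.ofBijective (fderiv ℝ G (φ c)).toLinearMap hbij).toContinuousLinearEquiv with hL
  have hLe : (L : E →L[ℝ] E) = fderiv ℝ G (φ c) := by
    ext v
    rfl
  have hstrict : HasStrictFDerivAt G (L : E →L[ℝ] E) (φ c) := by
    rw [hLe]
    exact hGs.hasStrictFDerivAt (by simp)
  have hGopen : map G (𝓝 (φ c)) = 𝓝 (G (φ c)) := hstrict.map_nhds_eq_of_equiv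
  -- the charts are open at `c` and `ψ (j c)`
  have hφmap : map φ (𝓝 c) = 𝓝 (φ c) := by
    rw [hφ, map_extChartAt_nhds, nhdsWithin_eq_nhds.2 hrange]
  have hGφc : G (φ c) = ψ (j c) := by
    simp only [hG, Function.comp_apply, hφ, extChartAt_to_inv]
  have hψmap : map ψ.symm (𝓝 (ψ (j c))) = 𝓝 (j c) := by
    have h := map_extChartAt_symm_nhdsWithin_range (I := IP) (j c)
    rwa [ModelWithCorners.Boundaryless.range_eq_univ, nhdsWithin_univ] at h
  -- `j = ψ⁻¹ ∘ G ∘ φ` near `c`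
  have hev : (ψ.symm ∘ G ∘ φ) =ᶠ[𝓝 c] j := by
    have h1 : φ.source ∈ 𝓝 c := extChartAt_source_mem_nhds c
    have h2 : j ⁻¹' ψ.source ∈ 𝓝 c :=
      hjc.continuousAt.preimage_mem_nhds (extChartAt_source_mem_nhds (j c))
    filter_upwards [h1, h2] with c' hc' hc''
    simp only [hG, Function.comp_apply, φ.left_inv hc', ψ.left_inv hc'']
  calc map j (𝓝 c) = map (ψ.symm ∘ G ∘ φ) (𝓝 c) := (map_congr hev).symm
    _ = map ψ.symm (map G (map φ (𝓝 c))) := by rw [← Filter.map_map, ← Filter.map_map]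
    _ = 𝓝 (j c) := by rw [hφmap, hGopen, hGφc, hψmap]

omit [IsManifold IP ∞ P] in
/-- **The image of the interior under a smooth equidimensional map with injective differential
into a boundaryless manifold is open.** (Lee 2013, Thm. 4.5 with Prop. 4.8.)
[cite: LeeSmoothManifolds2013, Thm. 4.5 and Prop. 4.8] -/
theorem isOpen_image_interior (hj : ContMDiff IC IP ∞ j)
    (hj' : ∀ c, Injective (mfderiv IC IP j c)) : IsOpen (j '' IC.interior C) := by
  rw [isOpen_iff_mem_nhds]
  rintro _ ⟨c, hc, rfl⟩
  rw [← map_nhds_eq_of_isInteriorPoint hj hj' hc]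
  exact image_mem_map ((ModelWithCorners.isOpen_interior (I := IC) (M := C) (n := ∞)
    (by simp)).mem_nhds hc)

end Interior

/-! ### Null sets in charts and the image of the boundary -/

section Boundary

variable {m : ℕ} {HP : Type*} [TopologicalSpace HP] {n : ℕ∞ω}
  {IP : ModelWithCorners ℝ (EuclideanSpace ℝ (Fin m)) HP}
  {P : Type*} [TopologicalSpace P] [ChartedSpace HP P] [IsManifold IP 1 P]
  [T3Space P] [MeasurableSpace P] [BorelSpace P]
  (h : ContMDiffRiemannianMetric IP n (EuclideanSpace ℝ (Fin m)) (TangentSpace IP : P → Type _))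

/-- **Lebesgue-null sets in a chart are null for the Riemannian measure**: if `B ⊆ ℝᵐ` is
measurable and Lebesgue-null then `φ.source ∩ φ⁻¹(B)` is `dV_h`-null, `φ` the extended chart at `x`
(the push-forward of `dV_h|_{φ.source}` under `φ` has the density `√det h_{ij}` with respect to
Lebesgue measure, `map_extChartAt_restrict_riemannianMeasure`). [cite: Federer1969, §3.2.46] -/
theorem riemannianMeasure_source_inter_preimage_eq_zero (x : P) {B : Set (EuclideanSpace ℝ (Fin m))}
    (hB : MeasurableSet B) (hB0 : volume B = 0) :
    riemannianMeasure h ((extChartAt IP x).source ∩ extChartAt IP x ⁻¹' B) = 0 := by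
  have hs : MeasurableSet (extChartAt IP x).source := (isOpen_extChartAt_source x).measurableSet
  rw [inter_comm, ← Measure.restrict_apply' hs,
    ← Measure.map_apply_of_aemeasurable (aemeasurable_extChartAt_restrict x _) hB,
    map_extChartAt_restrict_riemannianMeasure h x, withDensity_apply _ hB,
    Measure.restrict_restrict hB]
  exact setLIntegral_measure_zero _ _ (measure_inter_null_of_null_left _ hB0)

/-- A subset of `P` whose trace on every chart domain is contained in the preimage of a
Lebesgue-null set is `dV_h`-null (`P` second countable: countably many chart domains cover).
[cite: Federer1969, §3.2.46] -/
theorem riemannianMeasure_eq_zero_of_forall_chart [SecondCountableTopology P] {S : Set P}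
    (hS : ∀ x : P, ∃ B : Set (EuclideanSpace ℝ (Fin m)), volume B = 0 ∧
      (extChartAt IP x).source ∩ S ⊆ extChartAt IP x ⁻¹' B) :
    riemannianMeasure h S = 0 := by
  obtain ⟨s, hsc, hsU⟩ := TopologicalSpace.countable_cover_nhds
    fun x : P ↦ extChartAt_source_mem_nhds (I := IP) x
  have hcov : S ⊆ ⋃ x ∈ s, (extChartAt IP x).source ∩ S := by
    intro y hy
    have hy' : y ∈ ⋃ x ∈ s, (extChartAt IP x).source := hsU ▸ mem_univ y
    obtain ⟨x, hx, hyx⟩ := mem_iUnion₂.1 hy'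
    exact mem_iUnion₂.2 ⟨x, hx, hyx, hy⟩
  refine measure_mono_null hcov ((measure_biUnion_null_iff hsc).2 fun x _ ↦ ?_)
  obtain ⟨B, hB0, hB⟩ := hS x
  obtain ⟨B', hBB', hB'm, hB'0⟩ := exists_measurable_superset_of_null hB0
  refine measure_mono_null ?_ (riemannianMeasure_source_inter_preimage_eq_zero h x hB'm hB'0)
  exact fun y hy ↦ ⟨hy.1, hBB' (hB hy)⟩

variable [NeZero m]

omit [NeZero m] in
/-- The boundary hyperplane `{y | 0 = y 0}` of the half-space model is Lebesgue-null in `ℝᵐ`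
(a proper linear subspace). [folklore] -/
theorem volume_frontier_halfSpace_eq_zero [NeZero m] :
    volume {y : EuclideanSpace ℝ (Fin m) | 0 = y 0} = 0 := by
  let K : Submodule ℝ (EuclideanSpace ℝ (Fin m)) :=
    { carrier := {y | y 0 = 0}
      add_mem' := fun {a b} ha hb ↦ by
        simp only [mem_setOf_eq, PiLp.add_apply] at ha hb ⊢
        rw [ha, hb, add_zero]
      zero_mem' := by simp
      smul_mem' := fun r a ha ↦ by
        simp only [mem_setOf_eq, PiLp.smul_apply, smul_eq_mul] at ha ⊢
        rw [ha, mul_zero] }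
  have hsub : {y : EuclideanSpace ℝ (Fin m) | 0 = y 0} ⊆ (K : Set (EuclideanSpace ℝ (Fin m))) :=
    fun y hy ↦ (hy : 0 = y 0).symm
  have hK' : K ≠ ⊤ := by
    intro htop
    have hmem : EuclideanSpace.single (0 : Fin m) (1 : ℝ) ∈ K := htop ▸ Submodule.mem_top
    have h1 : EuclideanSpace.single (0 : Fin m) (1 : ℝ) 0 = 0 := hmem
    simp at h1
  exact measure_mono_null hsub (Measure.addHaar_submodule volume K hK')

variable {C : Type*} [TopologicalSpace C] [ChartedSpace (EuclideanHalfSpace m) C]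
  [IsManifold (𝓡∂ m) 1 C]

/-- **The image of the boundary of an equidimensional piece is a null set.** Let `C` be a `C¹`
manifold with boundary modelled on the half-space `ℝᵐ_{x₀ ≥ 0}`, second countable, `P` a manifold
modelled on `ℝᵐ` with a Riemannian metric `h`, and `j : C → P` of class `C¹`. Then
`dV_h(j(∂C)) = 0`: in a chart `φ` of `C` at `c` and `ψ` of `P` at `x`, the piece
`ψ(ψ.source ∩ j(∂C ∩ φ.source))` is the image under the `C¹` map `ψ ∘ j ∘ φ⁻¹` of a subset of the
hyperplane `{y₀ = 0}` (boundary points are read in any chart, `isBoundaryPoint_iff_of_mem_atlas`),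
hence Lebesgue-null (`addHaar_image_eq_zero_of_differentiableOn_of_addHaar_eq_zero`), and
Lebesgue-null sets in charts are `dV_h`-null; countably many charts cover.
[cite: Federer1969, §2.10.11 and §3.2.3] -/
theorem riemannianMeasure_image_boundary_eq_zero [SecondCountableTopology P]
    [SecondCountableTopology C] {j : C → P} (hj : ContMDiff (𝓡∂ m) IP 1 j) :
    riemannianMeasure h (j '' (𝓡∂ m).boundary C) = 0 := by
  -- countably many charts of `C` cover
  obtain ⟨s, hsc, hsU⟩ := TopologicalSpace.countable_cover_nhds
    fun c : C ↦ extChartAt_source_mem_nhds (I := 𝓡∂ m) c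
  have hcov : j '' (𝓡∂ m).boundary C ⊆
      ⋃ c ∈ s, j '' ((𝓡∂ m).boundary C ∩ (extChartAt (𝓡∂ m) c).source) := by
    rintro _ ⟨c', hc', rfl⟩
    have hc'' : c' ∈ ⋃ c ∈ s, (extChartAt (𝓡∂ m) c).source := hsU ▸ mem_univ c'
    obtain ⟨c, hc, hcc⟩ := mem_iUnion₂.1 hc''
    exact mem_iUnion₂.2 ⟨c, hc, mem_image_of_mem j ⟨hc', hcc⟩⟩
  refine measure_mono_null hcov ((measure_biUnion_null_iff hsc).2 fun c _ ↦ ?_)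
  -- one chart `φ` of `C`: read in every chart `ψ` of `P`
  refine riemannianMeasure_eq_zero_of_forall_chart h fun x ↦ ?_
  set φ := extChartAt (𝓡∂ m) c with hφ
  set ψ := extChartAt IP x with hψ
  set G : EuclideanSpace ℝ (Fin m) → EuclideanSpace ℝ (Fin m) := ψ ∘ j ∘ φ.symm with hG
  set T : Set (EuclideanSpace ℝ (Fin m)) :=
    (φ.target ∩ φ.symm ⁻¹' (j ⁻¹' ψ.source)) ∩ {y | 0 = y 0} with hT
  refine ⟨G '' T, ?_, ?_⟩
  · -- `G` is `C¹` on `T` and `T` is Lebesgue-null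
    have hGd : DifferentiableOn ℝ G T := by
      have h1 : ContDiffOn ℝ 1 G (φ.target ∩ φ.symm ⁻¹' (j ⁻¹' ψ.source)) :=
        (contMDiff_iff.1 hj).2 c x
      exact (h1.differentiableOn one_ne_zero).mono inter_subset_left
    exact addHaar_image_eq_zero_of_differentiableOn_of_addHaar_eq_zero volume hGd
      (measure_mono_null inter_subset_right volume_frontier_halfSpace_eq_zero)
  · -- `ψ.source ∩ j(∂C ∩ φ.source) ⊆ ψ⁻¹ (G T)`
    rintro y ⟨hyψ, c', ⟨hc'b, hc'φ⟩, rfl⟩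
    have hc'φ' : c' ∈ (chartAt (EuclideanHalfSpace m) c).source := by
      rwa [hφ, extChartAt_source] at hc'φ
    have hfr : φ c' ∈ {y : EuclideanSpace ℝ (Fin m) | 0 = y 0} := by
      rw [← frontier_range_modelWithCornersEuclideanHalfSpace m]
      -- boundary points are read in any chart: `φ c' ∈ frontier φ.target`, hence not an interior
      -- point of `range (𝓡∂ m)`
      have hft : φ c' ∈ frontier φ.target :=
        ((𝓡∂ m).isBoundaryPoint_iff_of_mem_atlas (n := (1 : ℕ∞ω)) (by simp)
          (chart_mem_atlas (EuclideanHalfSpace m) c) hc'φ').1 hc'b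
      have hzr : φ c' ∈ range (𝓡∂ m) := extChartAt_target_subset_range c (φ.map_source hc'φ)
      have hnot : φ c' ∉ interior (range (𝓡∂ m)) := fun hint ↦ by
        have hin : φ c' ∈ interior φ.target :=
          (chartAt (EuclideanHalfSpace m) c).mem_interior_extend_target (I := 𝓡∂ m)
            ((chartAt (EuclideanHalfSpace m) c).map_source hc'φ') hint
        exact Set.disjoint_left.1 disjoint_interior_frontier hin hft
      exact ⟨subset_closure hzr, hnot⟩
    refine ⟨φ c', ⟨⟨⟨φ.map_source hc'φ, ?_⟩, hfr⟩, ?_⟩⟩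
    · show j (φ.symm (φ c')) ∈ ψ.source
      rw [φ.left_inv hc'φ]
      exact hyψ
    · show ψ (j (φ.symm (φ c'))) = ψ (j c')
      rw [φ.left_inv hc'φ]

end Boundary

end BudgetTransfer

end Summit.SmoothPoincare4.SmoothPoincare4.Theorems

end
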